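import Summits.PneNP.PneNP.Theorems.SingleThreshold.Negative.LoadBearing
import Literature.Computability.Complexity.RossmanMonotoneCliqueGraphs
import Literature.Computability.Complexity.RossmanMonotoneCliqueLemma23Proofs
import Literature.Computability.Complexity.ProductWeights

/-!
# `SingleThreshold` (stmt-PneNP-2833) — negative-side lemmas IV: independence and locality tools

Infrastructure for the locality analysis of the crux (`Locality.lean`), in the finite-sum `G(n,q)`
vocabulary of `RossmanMonotoneClique.lean`:

* `gnpProb_and_eq_mul` — **independence**: an event determined by the edges in `F` and an event
  determined by the edges outside `F` multiply (product weight split along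
  `Equiv.piEquivPiSubtypeProd`, masses of the two halves are `1`).
* `inputList`, `eval_congr`, `length_inputList_le`, `arity_le_two_of_isOver` — **locality of
  circuits**: a `{∧₂,∨₂}`-circuit's value depends only on the `≤ 2·size + 1` variables it reads.
* `Touch`, `gnpProb_clique_touching_le` — **first moment for cliques touching `F`**:
  `Pr[some k-set A with K_A ⊆ G has an edge of K_A in F] ≤ |F| · C(n-2,k-2) · q^{C(k,2)}`.

Refuter seat cdisprove-stmt-PneNP-2833 (gen 1), 2026-08-16.
-/

namespace Summit.PneNP.PneNP.Theorems.SingleThreshold.Negative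

open Literature.Computability.Complexity Finset Filter Classical

noncomputable section

/-! ### Independence of events determined by disjoint coordinate sets -/

/-- **Independence in `G(n,q)`**: an event determined by the edges in `F` and an event determined
by the edges outside `F` are independent (product weight splits along
`Equiv.piEquivPiSubtypeProd`). [folklore] -/
theorem gnpProb_and_eq_mul {n : ℕ} (F : Finset (Edges n)) (P Q : (Edges n → Bool) → Prop)
    [DecidablePred P] [DecidablePred Q]
    (hP : ∀ x y : Edges n → Bool, (∀ e ∈ F, x e = y e) → (P x ↔ P y))
    (hQ : ∀ x y : Edges n → Bool, (∀ e ∉ F, x e = y e) → (Q x ↔ Q y)) (q : ℝ) :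
    gnpProb n q (univ.filter fun x => P x ∧ Q x) =
      gnpProb n q (univ.filter P) * gnpProb n q (univ.filter Q) := by
  classical
  -- coordinate weights
  let φ : Bool → ℝ := fun b => if b = true then q else 1 - q
  have hφsum : ∑ b : Bool, φ b = 1 := by simp [φ]
  have hw : ∀ x : Edges n → Bool, gnpWeight n q x = ∏ e, φ (x e) := fun x => gnpWeight_eq_prod q x
  -- split the coordinates by membership in `F`
  set p : Edges n → Prop := fun e => e ∈ F with hp
  clear_value p
  set σ := Equiv.piEquivPiSubtypeProd p (fun _ : Edges n => Bool) with hσ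
  let a₀ : {e // p e} → Bool := fun _ => false
  let b₀ : {e // ¬ p e} → Bool := fun _ => false
  -- the events seen on each side
  have hPsplit : ∀ (a : {e // p e} → Bool) (b : {e // ¬ p e} → Bool),
      P (σ.symm (a, b)) ↔ P (σ.symm (a, b₀)) := by
    intro a b
    refine hP _ _ fun e he => ?_
    have he' : p e := by rw [hp]; exact he
    simp [hσ, Equiv.piEquivPiSubtypeProd, he']
  have hQsplit : ∀ (a : {e // p e} → Bool) (b : {e // ¬ p e} → Bool),
      Q (σ.symm (a, b)) ↔ Q (σ.symm (a₀, b)) := by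
    intro a b
    refine hQ _ _ fun e he => ?_
    have he' : ¬ p e := by rw [hp]; exact he
    simp [hσ, Equiv.piEquivPiSubtypeProd, he']
  -- the weight factorises
  let wA : ({e // p e} → Bool) → ℝ := fun a => ∏ j, φ (a j)
  let wB : ({e // ¬ p e} → Bool) → ℝ := fun b => ∏ j, φ (b j)
  have hfac : ∀ a b, gnpWeight n q (σ.symm (a, b)) = wA a * wB b := by
    intro a b
    simp only [wA, wB]
    rw [hw, ← Fintype.prod_subtype_mul_prod_subtype p (fun e => φ (σ.symm (a, b) e))]
    congr 1
    · exact Fintype.prod_congr _ _ fun j => by simp [hσ, Equiv.piEquivPiSubtypeProd, j.2]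
    · exact Fintype.prod_congr _ _ fun j => by simp [hσ, Equiv.piEquivPiSubtypeProd, j.2]
  have hA1 : ∑ a, wA a = 1 := by
    simp only [wA]
    rw [ProductWeights.sum_prod_weight (ι := {e // p e}) (fun _ => φ)]
    simp only [hφsum, Finset.prod_const_one]
  have hB1 : ∑ b, wB b = 1 := by
    simp only [wB]
    rw [ProductWeights.sum_prod_weight (ι := {e // ¬ p e}) (fun _ => φ)]
    simp only [hφsum, Finset.prod_const_one]
  -- general reindexing of an event's probability
  have key : ∀ (R : (Edges n → Bool) → Prop) [DecidablePred R],
      gnpProb n q (univ.filter R) =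
        ∑ a, ∑ b, (if R (σ.symm (a, b)) then wA a * wB b else 0) := by
    intro R _
    rw [gnpProb_filter, ← Equiv.sum_comp σ.symm, Fintype.sum_prod_type]
    refine Finset.sum_congr rfl fun a _ => Finset.sum_congr rfl fun b _ => ?_
    rw [hfac]
  rw [key, key, key]
  -- evaluate the three sums
  have e1 : ∑ a, ∑ b, (if (P (σ.symm (a, b)) ∧ Q (σ.symm (a, b))) then wA a * wB b else 0) =
      (∑ a, if P (σ.symm (a, b₀)) then wA a else 0) * ∑ b, (if Q (σ.symm (a₀, b)) then wB b else 0) := by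
    rw [Finset.sum_mul_sum]
    refine Finset.sum_congr rfl fun a _ => Finset.sum_congr rfl fun b _ => ?_
    have h1 := hPsplit a b
    have h2 := hQsplit a b
    by_cases hp : P (σ.symm (a, b₀)) <;> by_cases hq : Q (σ.symm (a₀, b))
    · rw [if_pos ⟨h1.2 hp, h2.2 hq⟩, if_pos hp, if_pos hq]
    · rw [if_neg (fun h => hq (h2.1 h.2)), if_pos hp, if_neg hq, mul_zero]
    · rw [if_neg (fun h => hp (h1.1 h.1)), if_neg hp, zero_mul]
    · rw [if_neg (fun h => hp (h1.1 h.1)), if_neg hp, zero_mul]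
  have e2 : ∑ a, ∑ b, (if P (σ.symm (a, b)) then wA a * wB b else 0) =
      ∑ a, if P (σ.symm (a, b₀)) then wA a else 0 := by
    refine Finset.sum_congr rfl fun a _ => ?_
    by_cases hp : P (σ.symm (a, b₀))
    · rw [if_pos hp]
      calc ∑ b, (if P (σ.symm (a, b)) then wA a * wB b else 0) = ∑ b, wA a * wB b :=
            Finset.sum_congr rfl fun b _ => if_pos ((hPsplit a b).2 hp)
        _ = wA a := by rw [← Finset.mul_sum, hB1, mul_one]
    · rw [if_neg hp]
      exact Finset.sum_eq_zero fun b _ => if_neg (fun h => hp ((hPsplit a b).1 h))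
  have e3 : ∑ a, ∑ b, (if Q (σ.symm (a, b)) then wA a * wB b else 0) =
      ∑ b, (if Q (σ.symm (a₀, b)) then wB b else 0) := by
    rw [Finset.sum_comm]
    calc ∑ b, ∑ a, (if Q (σ.symm (a, b)) then wA a * wB b else 0)
        = ∑ b, (if Q (σ.symm (a₀, b)) then wB b else 0) * ∑ a, wA a := by
          refine Finset.sum_congr rfl fun b _ => ?_
          by_cases hq : Q (σ.symm (a₀, b))
          · rw [if_pos hq, Finset.mul_sum]
            exact Finset.sum_congr rfl fun a _ => by rw [if_pos ((hQsplit a b).2 hq)]; ring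
          · rw [if_neg hq, zero_mul]
            exact Finset.sum_eq_zero fun a _ => if_neg (fun h => hq ((hQsplit a b).1 h))
      _ = ∑ b, (if Q (σ.symm (a₀, b)) then wB b else 0) := by
          refine Finset.sum_congr rfl fun b _ => ?_
          rw [hA1, mul_one]
  rw [e1, e2, e3]

/-! ### Locality of circuit evaluation: a circuit reads at most `2·size + 1` variables -/

/-- The input variables read by a gate. [folklore] -/
def gateInputs {ι : Type*} (g : Gate ι) : List ι :=
  (List.finRange g.arity).filterMap fun a => (g.args a).getLeft?

/-- Bookkeeping. [folklore] -/
theorem mem_gateInputs {ι : Type*} {g : Gate ι} {a : Fin g.arity} {i : ι}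
    (h : g.args a = Sum.inl i) : i ∈ gateInputs g := by
  simp only [gateInputs, List.mem_filterMap, List.mem_finRange, true_and]
  exact ⟨a, by rw [h]; rfl⟩

/-- Bookkeeping. [folklore] -/
theorem length_gateInputs_le {ι : Type*} (g : Gate ι) : (gateInputs g).length ≤ g.arity := by
  unfold gateInputs
  calc _ ≤ (List.finRange g.arity).length := List.length_filterMap_le _ _
    _ = g.arity := List.length_finRange

/-- All input variables a circuit reads (gate arguments and, possibly, the output wire). [folklore] -/
def inputList {ι : Type*} (C : Circuit ι) : List ι :=
  C.gates.flatMap gateInputs ++ C.output.getLeft?.toList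

/-- Gate values depend only on the variables the gates read. [folklore] -/
theorem wireVals_congr {ι : Type*} (C : Circuit ι) {x y : ι → Bool}
    (h : ∀ g ∈ C.gates, ∀ i ∈ gateInputs g, x i = y i) : C.wireVals x = C.wireVals y := by
  unfold Circuit.wireVals
  suffices ∀ (gs : List (Gate ι)) (acc : List Bool), (∀ g ∈ gs, ∀ i ∈ gateInputs g, x i = y i) →
      gs.foldl (fun vals g => vals ++ [g.op fun a => match g.args a with
        | .inl i => x i | .inr m => vals.getD m false]) acc =
      gs.foldl (fun vals g => vals ++ [g.op fun a => match g.args a with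
        | .inl i => y i | .inr m => vals.getD m false]) acc from this C.gates [] h
  intro gs
  induction gs with
  | nil => intro acc _; rfl
  | cons g gs ih =>
    intro acc hgs
    simp only [List.foldl_cons]
    have hg : (g.op fun a => match g.args a with | .inl i => x i | .inr m => acc.getD m false) =
        (g.op fun a => match g.args a with | .inl i => y i | .inr m => acc.getD m false) := by
      congr 1
      funext a
      rcases hga : g.args a with i | m
      · exact hgs g List.mem_cons_self i (mem_gateInputs hga)
      · rfl
    rw [hg]
    exact ih _ fun g' hg' => hgs g' (List.mem_cons_of_mem _ hg')

/-- **Locality**: the value of a circuit depends only on the variables it reads. [folklore] -/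
theorem eval_congr {ι : Type*} (C : Circuit ι) {x y : ι → Bool}
    (h : ∀ i ∈ inputList C, x i = y i) : C.eval x = C.eval y := by
  have hg : ∀ g ∈ C.gates, ∀ i ∈ gateInputs g, x i = y i := fun g hg i hi =>
    h i (List.mem_append_left _ (List.mem_flatMap.2 ⟨g, hg, hi⟩))
  have hw := wireVals_congr C hg
  unfold Circuit.eval
  rcases hout : C.output with i | m
  · apply h
    simp [inputList, hout]
  · rw [hw]

/-- Over a fan-in-`2` basis a circuit reads at most `2·size + 1` variables. [folklore] -/
theorem length_inputList_le {ι : Type*} (C : Circuit ι) (hC : ∀ g ∈ C.gates, g.arity ≤ 2) :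
    (inputList C).length ≤ 2 * C.size + 1 := by
  have h1 : ∀ gs : List (Gate ι), (∀ g ∈ gs, g.arity ≤ 2) →
      (gs.flatMap gateInputs).length ≤ 2 * gs.length := by
    intro gs hgs
    induction gs with
    | nil => simp
    | cons g gs ih =>
      simp only [List.flatMap_cons, List.length_append, List.length_cons]
      have h₁ := length_gateInputs_le g
      have h₂ := hgs g List.mem_cons_self
      have h₃ := ih fun g' hg' => hgs g' (List.mem_cons_of_mem _ hg')
      omega
  have h2 : C.output.getLeft?.toList.length ≤ 1 := by
    cases C.output <;> simp
  unfold inputList Circuit.size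
  rw [List.length_append]
  have := h1 C.gates hC
  omega

/-- Gates over `{∧₂, ∨₂}` have fan-in `2`. [folklore] -/
theorem arity_le_two_of_isOver {ι : Type*} {C : Circuit ι} (hC : C.IsOver monotoneBasis) :
    ∀ g ∈ C.gates, g.arity ≤ 2 := by
  intro g hg
  have h := hC g hg
  simp only [monotoneBasis, Set.mem_insert_iff, Set.mem_singleton_iff] at h
  rcases h with h | h
  · have := congrArg Sigma.fst h
    simp only [Gate.fn, GateFn.and] at this
    omega
  · have := congrArg Sigma.fst h
    simp only [Gate.fn, GateFn.or] at this
    omega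

/-! ### Cliques touching a small edge set are unlikely -/

/-- "Some `k`-clique of `x` has an edge in `F`". [folklore] -/
def Touch (n k : ℕ) (F : Finset (Edges n)) (x : Edges n → Bool) : Prop :=
  ∃ A ∈ powersetCard k (univ : Finset (Fin n)),
    (∀ e, cliqueVec A e = true → x e = true) ∧ ∃ e ∈ F, cliqueVec A e = true


/-- `Pr[some k-set A with K_A ⊆ G(n,q) has an edge of K_A in F] ≤ |F| · C(n-2, k-2) · q^{C(k,2)}`.
[folklore] -/
theorem gnpProb_clique_touching_le {n k : ℕ} (F : Finset (Edges n)) {q : ℝ} (hq0 : 0 ≤ q)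
    (hq1 : q ≤ 1) :
    gnpProb n q (univ.filter fun x => Touch n k F x)
      ≤ #F * ((n - 2).choose (k - 2) : ℝ) * q ^ (k.choose 2) := by
  classical
  set T : Finset (Finset (Fin n)) :=
    (powersetCard k univ).filter fun A => ∃ e ∈ F, cliqueVec A e = true with hT
  have hunion := Rossman2010L23.gnpProb_filter_le_sum (n := n) hq0 hq1 T
    (fun x => Touch n k F x)
    (fun A x => ∀ e, cliqueVec A e = true → x e = true)
    (fun x hx => by
      obtain ⟨A, hA, hsub, htouch⟩ := hx
      exact ⟨A, mem_filter.2 ⟨hA, htouch⟩, hsub⟩)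
  refine hunion.trans ?_
  have hterm : ∀ A ∈ T, gnpProb n q (univ.filter fun x => ∀ e, cliqueVec A e = true → x e = true) =
      q ^ (k.choose 2) := by
    intro A hA
    rw [Rossman2010L23.gnpProb_sub, (mem_powersetCard.1 (mem_filter.1 hA).1).2]
  rw [sum_congr rfl hterm, sum_const, nsmul_eq_mul]
  refine mul_le_mul_of_nonneg_right ?_ (pow_nonneg hq0 _)
  -- `#T ≤ |F| · C(n-2, k-2)`
  have hTsub : T ⊆ F.biUnion fun e => (powersetCard k univ).filter fun A => endpts e ⊆ A := by
    intro A hA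
    rw [mem_filter] at hA
    obtain ⟨e, he, hce⟩ := hA.2
    exact mem_biUnion.2 ⟨e, he, mem_filter.2 ⟨hA.1, (cliqueVec_eq_true_iff_endpts A e).1 hce⟩⟩
  calc (#T : ℝ) ≤ #(F.biUnion fun e => (powersetCard k univ).filter fun A => endpts e ⊆ A) := by
        exact_mod_cast card_le_card hTsub
    _ ≤ ∑ e ∈ F, (#((powersetCard k univ).filter fun A => endpts e ⊆ A) : ℝ) := by
        exact_mod_cast card_biUnion_le
    _ ≤ ∑ e ∈ F, ((n - 2).choose (k - 2) : ℝ) := by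
        refine sum_le_sum fun e _ => ?_
        have h := card_filter_supset_le (k := k) (endpts e)
        rw [card_endpts] at h
        exact_mod_cast h
    _ = #F * ((n - 2).choose (k - 2) : ℝ) := by rw [sum_const, nsmul_eq_mul]

end

end Summit.PneNP.PneNP.Theorems.SingleThreshold.Negative
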